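import Literature.AnabelianGeometry.AbsoluteAnabelian.AbsTopII.SemiEllipticTorsionFree
import Literature.AnabelianGeometry.AbsoluteAnabelian.AbsTopII.CuspidalizationChains
import HarnessLib

/-!
# [AbsTopII] Cor 3.3 — the OUTPUT structure with PRINT-FAITHFUL torsion-freeness of `Π_D ∩ Δ_C`
# (successor `EllipticCuspidalizationTF` of `EllipticCuspidalization`; finding T1g11-F1)

S. Mochizuki, *Topics in Absolute Anabelian Geometry II: Decomposition Groups and Endomorphisms*
[AbsTopII] (bib `MochizukiAbsTopII2013`; kurims manuscript `paper:url-585b8d0ad0d9`, cell render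
`HOME/lit/renders/AbsTopII-kurims-url-585b8d0ad0d9/p0068.txt`), §3, Corollary 3.3 pp. 67–69; (ii)
p. 68: "… open subgroups `J ⊆ Π_C` of index `2` such that `J ∩ Δ_C` [where `Δ_C := Ker(Π_C ↠ G')`]
is torsion-free [i.e., the covering determined by `J` is a scheme — cf. [AbsTopI], Lemma 4.1, (iv)]."

WHY THIS FILE (cell abc-iut, row «TORSIONFREE-SUCCESSOR» phase 2, abc-iut-L4-lead m151 (6) /
m156 (2); seat abc-iut-L4-t4 gen 12).  The landed OUTPUT structure `EllipticCuspidalization E`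
(abc-iut-L4-t6 / -t12, `EllipticCuspidalization.lean`) — the data the group-theoretic algorithm of
Cor 3.3 (i)(ii)(iii) constructs — carries the clause (ii) as the field
`torsionFree_PiD : IsMulTorsionFree ↥(PiD ⊓ core.geom)`, Mathlib's UNIQUE-ROOTS class.  By finding
T1g11-F1 that field is UNSATISFIABLE at genuine data (`Π_D ∩ Δ_C = Δ_D` free profinite of rank `2`:
abc-iut-L4-t12's `Summit.ABC.IUTFork.ellipticCuspidalization_not_surjective_S3`,
`not_isMulTorsionFree_of_isFreeProOn`), so the structure is UNINHABITED there and every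
"`∃ C : EllipticCuspidalization …`" conclusion (`EllipticModel.Cor_3_3_iii`, F-0291, with its `Matches` clause F-0293;
`EllipticDatumModel.Cor_3_3_iii'`) is FALSE at genuine shape as typed.  DEFS-freeze: the landed
structure is not edited.  This file mints the SUCCESSOR structure `EllipticCuspidalizationTF E` —
the SAME 28 fields verbatim except (ii), which becomes print's «`∀ g : ↥(Π_D ⊓ Δ_C), IsOfFinOrder g
→ g = 1`» (the cell currency; abc-iut-L5-t1's `htf⁰`) — together with
* the one-way bridge `EllipticCuspidalization.toTF` (unique roots ⇒ torsion-free), so every landed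
  CONSTRUCTION of an output transfers, with `rfl` projections (`toTF_core`, `toTF_PiD`, …,
  `toTF_toCuspidalization`);
* the successor's copy of the landed API: `PiUV`, `typeChain`, `removedPointDecomposition`,
  `toCuspidalization`, `normal_PiUV` (a THEOREM, no instance — F25-A1),
  `conjProdQuot_PiUV_injective` (the predecessor's bookkeeping lemmas `ker_proj_le_PiUV` /
  `removedPointDecomposition_le_range` are Mathlib one-liners — `MonoidHom.mem_ker` / `Subgroup.map_le_range`
  — and are not re-minted: gate dedup), and
  `PiD_mem_semiEllipticDoubleCoverSubgroupsTF` (the output's `Π_D` lies in the print-faithful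
  right-hand side of Cor 3.3 (ii), `SemiEllipticTorsionFree.lean`).
The `(𝒟, M)`-relative statements over the successor (`MatchesTF`, `Cor_3_3_iiiTF`, …) are the sequel
`EllipticCuspidalizationComparisonTFOutput.lean`.

HONEST FRAMING: a re-typing of OUR output format; typed ≠ constructed; nothing here bears on
[IUTchIII] Cor 3.12 or asserts that abc is proved or refuted.  No instance, no notation; axioms
standard.
-/

open CategoryTheory Topology

universe u

namespace Literature.AnabelianGeometry.AbsoluteAnabelian.AbsTopII

open Literature.AnabelianGeometry.Anabelioids (IsSigmaInteger)
open Literature.AnabelianGeometry.EtaleTheta (Out innerAut)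
open FundamentalExtension

/-! ### The successor output structure -/

/-- **Corollary 3.3** pp. 67–69, OUTPUT STRUCTURE (shape (1)) over an abstract extension `E`
(= `1 → Δ' → Π' → G' → 1`), PRINT-FAITHFUL SUCCESSOR of `EllipticCuspidalization` (finding T1g11-F1):
the data the group-theoretic algorithm (i), (ii), (iii) (a)(b)(c) constructs, with the printed
properties — (i) the `k'`-core `Π' ⇝ Π_C`; (ii) `Π_D ⊆ Π_C` open of index `2` with `Π_D ∩ Δ_C`
torsion-free, i.e. WITHOUT NONTRIVIAL ELEMENTS OF FINITE ORDER ("[i.e., the covering determined by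
`J` is a scheme — cf. [AbsTopI], Lemma 4.1, (iv)]"); (iii) `N` a `Σ`-integer, `Π_V ⊆ Π'` normal open
with `Π_V ↪ Π_D`, the cuspidalizations `Π_U ↠ Π_D` and `Π_{U_X} ↠ Π'` glued along `Π_{U_V}`, the
unique-lifting and `⋊^out` clauses of (b), and (c) the decomposition groups of the removed points.
All fields other than (ii) are VERBATIM those of the predecessor.
[cite: MochizukiAbsTopII2013, Cor 3.3 pp.67-69] -/
structure EllipticCuspidalizationTF (E : FundamentalExtension.{u}) : Type (u + 1) where
  /-- (iii) the positive integer `N`, "a product of primes [perhaps with multiplicities] of `Σ`" -/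
  N : ℕ
  /-- the set of primes `Σ` of the partial construction data `(k, X, Σ)` -/
  Sigma : Set ℕ
  /-- (iii) `N` is a `Σ`-integer -/
  N_isSigmaInteger : IsSigmaInteger Sigma N
  /-- (i) the extension `Π_C ↠ G'` of the `k'`-core `C` -/
  core : FundamentalExtension.{u}
  /-- (i) the chain `Π' ⇝ Π_C` of type `⋎`: `Π'` is an open subgroup of `Π_C` over `G'` -/
  toCore : E ⟶ core
  /-- (i) `Π' ↪ Π_C`, `G' → G_C` open injective … -/
  toCore_isOpenInjective : toCore.IsOpenInjective
  /-- (i) … and over `G'` (`C` is a `k'`-core: same base field) -/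
  toCore_gal_bijective : Function.Bijective toCore.gal
  /-- (ii) the open subgroup `Π_D ⊆ Π_C` of the double covering `D → C` … -/
  PiD : Subgroup core.arith
  /-- (ii) … open … -/
  isOpen_PiD : IsOpen (PiD : Set core.arith)
  /-- (ii) … "of index `2`" … -/
  index_PiD : PiD.index = 2
  /-- (ii) … "such that `J ∩ Δ_C` is torsion-free [i.e., the covering [...] is a scheme]" —
  PRINT-FAITHFUL: no nontrivial element of finite order (finding T1g11-F1; the predecessor's field
  is Mathlib's unique-roots class `IsMulTorsionFree`) -/
  torsionFree_PiD : ∀ g : ↥(PiD ⊓ core.geom), IsOfFinOrder g → g = 1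
  /-- (iii) `Π_V ⊆ Π'`, "a normal open subgroup" (`V → X` Galois) … -/
  PiV : Subgroup E.arith
  /-- (iii) … normal … -/
  normal_PiV : PiV.Normal
  /-- (iii) … open -/
  isOpen_PiV : IsOpen (PiV : Set E.arith)
  /-- (iii) "`V → D` arises from an open immersion `Π_V ↪ Π_D`" -/
  map_PiV_le : PiV.map toCore.arith.toMonoidHom ≤ PiD
  /-- (iii)(a) the extension `1 → Δ_U → Π_U → G' → 1` of `U := D ∖ (N-torsion)` … -/
  cuspU : FundamentalExtension.{u}
  /-- (iii)(a) … with "the natural surjection `Π_U ↠ Π_D`", recovered "from the chain of •'s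
  terminating at the third to last group" of the `Π`-chain of type `Ex_3_2_ii_typeChain N` -/
  projU : cuspU ⟶ core
  /-- (iii)(a) `Π_U ↠ Π_D`: the image is `Π_D` … -/
  range_projU : projU.arith.toMonoidHom.range = PiD
  /-- (iii)(a) … over the same Galois group -/
  projU_gal_bijective : Function.Bijective projU.gal
  /-- (iii) the extension `1 → Δ_{U_X} → Π_{U_X} → G' → 1` … -/
  cuspUX : FundamentalExtension.{u}
  /-- (iii) … with THE OUTPUT: "the natural surjection `Π_{U_X} ↠ Π` — i.e., 'cuspidalization'
  of `Π`" -/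
  proj : cuspUX ⟶ E
  /-- `Π_{U_X} ↠ Π'` is surjective … -/
  proj_arith_surjective : Function.Surjective proj.arith
  /-- … and over the same Galois group `G'` -/
  proj_gal_bijective : Function.Bijective proj.gal
  /-- (iii)(a)/(b) "`Π_{U_V} ↠ Π_V` may be identified with the fibre product of `Π_{U_X} ↠ Π`
  with `Π_V ↪ Π`" and is "recovered from `Π_U ↠ Π_D` by forming the fibre product with
  `Π_V ↪ Π_D`": the identification of the two preimages of `Π_V` … -/
  glue : ↥(PiV.comap proj.arith.toMonoidHom) ≃*
    ↥((PiV.map toCore.arith.toMonoidHom).comap projU.arith.toMonoidHom)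
  /-- … compatible with the two projections to `Π_V ⊆ Π_D` -/
  glue_comm : ∀ x : ↥(PiV.comap proj.arith.toMonoidHom),
    toCore.arith (proj.arith x) = projU.arith (glue x)
  /-- (iii)(b), uniqueness: an outer action of `Π'` trivial on `Π_V` (i.e. of "the finite group
  `Π/Π_V`") on `Π_{U_V}` lifting the conjugation action on `Π_V` along `Π_{U_V} ↠ Π_V` is UNIQUE -/
  lifting_unique : ∀ ρ ρ' : E.arith →* Out ↥(PiV.comap proj.arith.toMonoidHom),
    PiV ≤ ρ.ker → PiV ≤ ρ'.ker →
    IsOuterLifting (proj.arith.toMonoidHom.comp (PiV.comap proj.arith.toMonoidHom).subtype) ρ →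
    IsOuterLifting (proj.arith.toMonoidHom.comp (PiV.comap proj.arith.toMonoidHom).subtype) ρ' →
      ρ = ρ'
  /-- (iii)(b), reconstruction "by forming the `⋊^out`": `Π_{U_V}` has trivial centre, so that
  `Π_{U_X} = Π_{U_V} ⋊^out (Π_{U_X}/Π_{U_V})`, `Π_{U_X}/Π_{U_V} = Π'/Π_V`
  (`conjProdQuot_injective`, `mem_range_conjProdQuot_iff`) -/
  center_PiUV_eq_bot : Subgroup.center ↥(PiV.comap proj.arith.toMonoidHom) = ⊥
  /-- (iii)(c) the cusps of `U_X` with their decomposition groups in `Π_{U_X}` ("the cuspidal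
  decomposition groups of `Π_{U_X}` [cf. [AbsTopI], Lemma 4.5, (v)]") -/
  cusps : CuspidalData cuspUX

/-! ### The one-way bridge from the predecessor -/

/-- **Unique roots ⇒ torsion-free**: every landed `EllipticCuspidalization` IS a print-faithful one
(all fields kept, (ii) weakened along Mathlib `IsOfFinOrder.eq_one'`).  The converse direction does
not exist at genuine data (the predecessor is uninhabited there).
[cite: MochizukiAbsTopII2013, Cor 3.3 (ii) p.68] -/
def EllipticCuspidalization.toTF {E : FundamentalExtension.{u}} (K : EllipticCuspidalization E) :
    EllipticCuspidalizationTF E where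
  N := K.N
  Sigma := K.Sigma
  N_isSigmaInteger := K.N_isSigmaInteger
  core := K.core
  toCore := K.toCore
  toCore_isOpenInjective := K.toCore_isOpenInjective
  toCore_gal_bijective := K.toCore_gal_bijective
  PiD := K.PiD
  isOpen_PiD := K.isOpen_PiD
  index_PiD := K.index_PiD
  torsionFree_PiD := inf_geom_torsionFree_of_isMulTorsionFree K.torsionFree_PiD
  PiV := K.PiV
  normal_PiV := K.normal_PiV
  isOpen_PiV := K.isOpen_PiV
  map_PiV_le := K.map_PiV_le
  cuspU := K.cuspU
  projU := K.projU
  range_projU := K.range_projU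
  projU_gal_bijective := K.projU_gal_bijective
  cuspUX := K.cuspUX
  proj := K.proj
  proj_arith_surjective := K.proj_arith_surjective
  proj_gal_bijective := K.proj_gal_bijective
  glue := K.glue
  glue_comm := K.glue_comm
  lifting_unique := K.lifting_unique
  center_PiUV_eq_bot := K.center_PiUV_eq_bot
  cusps := K.cusps

namespace EllipticCuspidalization

variable {E : FundamentalExtension.{u}} (K : EllipticCuspidalization E)

/-- `toTF` keeps `N`. [cite: MochizukiAbsTopII2013, Cor 3.3 (iii) p.68] -/
@[simp] theorem toTF_N : K.toTF.N = K.N := rfl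

/-- `toTF` keeps `Σ`. [cite: MochizukiAbsTopII2013, Cor 3.3 p.67] -/
@[simp] theorem toTF_Sigma : K.toTF.Sigma = K.Sigma := rfl

/-- `toTF` keeps the core `Π_C ↠ G'`. [cite: MochizukiAbsTopII2013, Cor 3.3 (i) p.68] -/
@[simp] theorem toTF_core : K.toTF.core = K.core := rfl

/-- `toTF` keeps `Π' ⇝ Π_C`. [cite: MochizukiAbsTopII2013, Cor 3.3 (i) p.68] -/
@[simp] theorem toTF_toCore : K.toTF.toCore = K.toCore := rfl

/-- `toTF` keeps `Π_D`. [cite: MochizukiAbsTopII2013, Cor 3.3 (ii) p.68] -/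
@[simp] theorem toTF_PiD : K.toTF.PiD = K.PiD := rfl

/-- `toTF` keeps `Π_V`. [cite: MochizukiAbsTopII2013, Cor 3.3 (iii) p.68] -/
@[simp] theorem toTF_PiV : K.toTF.PiV = K.PiV := rfl

/-- `toTF` keeps `Π_{U_X}`. [cite: MochizukiAbsTopII2013, Cor 3.3 (iii) p.68] -/
@[simp] theorem toTF_cuspUX : K.toTF.cuspUX = K.cuspUX := rfl

/-- `toTF` keeps the output `Π_{U_X} ↠ Π'`. [cite: MochizukiAbsTopII2013, Cor 3.3 (iii) p.68] -/
@[simp] theorem toTF_proj : K.toTF.proj = K.proj := rfl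

/-- `toTF` keeps the cusps of `U_X`. [cite: MochizukiAbsTopII2013, Cor 3.3 (iii)(c) p.69] -/
@[simp] theorem toTF_cusps : K.toTF.cusps = K.cusps := rfl

end EllipticCuspidalization

/-! ### The successor's API (verbatim copy of the landed one) -/

namespace EllipticCuspidalizationTF

variable {E : FundamentalExtension.{u}} (C : EllipticCuspidalizationTF E)

/-- `Π_{U_V} ⊆ Π_{U_X}`: the preimage of `Π_V` under the cuspidalization `Π_{U_X} ↠ Π'`
(Cor 3.3 (iii), bracket in (b)). [cite: MochizukiAbsTopII2013, Cor 3.3 (iii)(b) p.69] -/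
def PiUV : Subgroup C.cuspUX.arith := C.PiV.comap C.proj.arith.toMonoidHom

/-- The type-chain of the `Π`-chain of (iii)(a): "`⋏, ⋎, ⋏, •, …, •, ⋏, ⋎` — cf. Example 3.2,
(ii)". [cite: MochizukiAbsTopII2013, Cor 3.3 (iii)(a) p.68] -/
def typeChain : List ElementaryOp := Ex_3_2_ii_typeChain C.N

/-- **Cor 3.3 (iii) (c)** p. 69 (REAL on the output): "The decomposition groups of the closed
points of `X` lying in the complement of `U_X` may be obtained as the images via `Π_{U_X} ↠ Π` of
the cuspidal decomposition groups of `Π_{U_X}`." [cite: MochizukiAbsTopII2013, Cor 3.3 (iii)(c) p.69] -/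
def removedPointDecomposition (x : C.cusps.Cusp) : Subgroup E.arith :=
  (C.cusps.Dcusp x).map C.proj.arith.toMonoidHom

/-- The output `Π_{U_X} ↠ Π` as a `Cuspidalization` (the common format of §3 outputs).
[cite: MochizukiAbsTopII2013, Cor 3.3 (iii) p.68] -/
def toCuspidalization : Cuspidalization E :=
  ⟨C.cuspUX, C.proj, C.proj_arith_surjective, C.proj_gal_bijective⟩

/-- `Π_{U_V}` is normal in `Π_{U_X}` (preimage of the normal subgroup `Π_V`) — a THEOREM, not an
instance (consumers `haveI`). [cite: MochizukiAbsTopII2013, Cor 3.3 (iii)(b) p.69] -/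
theorem normal_PiUV : C.PiUV.Normal := by
  haveI := C.normal_PiV
  exact Subgroup.Normal.comap inferInstance _

/-- (iii)(b) made explicit (PROVED from `center_PiUV_eq_bot`): `Π_{U_X}` embeds in
`Aut(Π_{U_V}) × Π_{U_X}/Π_{U_V}` with image `Π_{U_V} ⋊^out (Π_{U_X}/Π_{U_V})`.
[cite: MochizukiAbsTopII2013, Cor 3.3 (iii)(b) p.69] -/
theorem conjProdQuot_PiUV_injective :
    haveI := C.normal_PiUV; Function.Injective (conjProdQuot C.PiUV) := by
  haveI := C.normal_PiUV
  exact conjProdQuot_injective C.PiUV C.center_PiUV_eq_bot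

/-- **The output's `Π_D` lies in the PRINT-FAITHFUL right-hand side of Cor 3.3 (ii)** for the core
(open, index `2`, `Π_D ∩ Δ_C` without nontrivial elements of finite order).
[cite: MochizukiAbsTopII2013, Cor 3.3 (ii) p.68] -/
theorem PiD_mem_semiEllipticDoubleCoverSubgroupsTF :
    C.PiD ∈ semiEllipticDoubleCoverSubgroupsTF C.core :=
  ⟨C.isOpen_PiD, C.index_PiD, C.torsionFree_PiD⟩

end EllipticCuspidalizationTF

namespace EllipticCuspidalization

variable {E : FundamentalExtension.{u}} (K : EllipticCuspidalization E)

/-- `toTF` commutes with `toCuspidalization` (definitionally).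
[cite: MochizukiAbsTopII2013, Cor 3.3 (iii) p.68] -/
@[simp] theorem toTF_toCuspidalization : K.toTF.toCuspidalization = K.toCuspidalization := rfl

/-- `toTF` keeps the type-chain. [cite: MochizukiAbsTopII2013, Cor 3.3 (iii)(a) p.68] -/
@[simp] theorem toTF_typeChain : K.toTF.typeChain = K.typeChain := rfl

/-- `toTF` keeps `Π_{U_V}`. [cite: MochizukiAbsTopII2013, Cor 3.3 (iii)(b) p.69] -/
@[simp] theorem toTF_PiUV : K.toTF.PiUV = K.PiUV := rfl

/-- `toTF` keeps the removed-point decomposition groups.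
[cite: MochizukiAbsTopII2013, Cor 3.3 (iii)(c) p.69] -/
@[simp] theorem toTF_removedPointDecomposition (x : K.cusps.Cusp) :
    K.toTF.removedPointDecomposition x = K.removedPointDecomposition x := rfl

end EllipticCuspidalization

end Literature.AnabelianGeometry.AbsoluteAnabelian.AbsTopII
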